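import Mathlib
import HarnessLib
import Summits.Ventures.LatticeQCDFlow.Exactness.IMHSignObservableSandwich
import Summits.Ventures.LatticeQCDFlow.Exactness.SphereIndependenceSamplerAcceptance
import Summits.Ventures.LatticeQCDFlow.Exactness.LatticeBlockSecondMomentTensorization

/-!
# The integrated autocorrelation time of an EVENT along an independence sampler on the lattice of spheres: for every event `A` of target probability `p ∈ (0,1)`, `(p∧(1−p))/(p∨(1−p))·∫e^{−2F}/(∫e^{−F})² − ½ ≤ τ_int(1_A) ≤ ½ + 12·(p∨(1−p))/(p∧(1−p))·∫e^{−2F}/(∫e^{−F})²`, and the block tensorization of the floor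

HONEST FRAMING: exact (Metropolis-corrected) sampling algorithms for lattice gauge theory;
figures of merit are autocorrelation/cost numbers at stated couplings and volumes; no
continuum-physics claim.

Venture `LatticeQCDFlow` (cell pub-lqcd), topic `Exactness`; FANOUT row 7 (`s0-cpn-null`: the
S0-D1 rung — 2D CP⁹, Lüscher's LO trivializing map inside HMC, Engel–Schaefer 2011).  NEW WORK of
the cell over row 2's `Exactness/IMHSignObservableSandwich.lean` / `IMHTauIntLeInvESS.lean`
(`imhOp_tauInt_ge_weightMean`: `τ_int(g) ≥ ∫g²bw/(Z∫g²w) − ½`; `imhOp_tauInt_le_invESS`: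
`τ_int(g) ≤ ½ + 12B²W₂/(Z∫g²w)` for bounded centred `g` of the exact flow sampler with
square-integrable weights on a general state space), this lineage's
`Exactness/SphereIndependenceSamplerAcceptance.lean` (the lattice-of-spheres vocabulary) and
`Exactness/LatticeBlockSecondMomentTensorization.lean` (the non-product tensorization of the second
moment of the weights); nothing is cited as a fact.  Printed counterparts, NAMED ONLY:
Albergo–Kanwar–Shanahan 2019 §II; Madras–Sokal 1988 / Wolff 2004 (`τ_int`); Abbott et al. 2022 §V;
the topological-freezing diagnostics of the field (autocorrelation of topological-sector
indicators).  THE OBSERVABLES OF TOPOLOGICAL FREEZING.  The companion file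
`SphereIndependenceSamplerSignTauInt` treats balanced sign observables (`g² = 1`); here the
restriction to target probability `½` is removed: for the independence sampler with continuous
log-weight `F` on `Ω = S(E)^Λ` (target `γ = e^{−F}π̄/Z`, proposal `π̄`, row 2's `imhOp π̄ e^{−F} 1`)
and EVERY event `A ⊆ Ω` with `p = γ(A) ∈ (0, 1)` — a topological sector, a sign of a charge, any
non-trivial yes/no question — the centred indicator `1_A − p` (`|1_A − p| ≤ p ∨ (1−p)`,
`(1_A − p)² ≥ (p ∧ (1−p))²`, `∫(1_A − p)²e^{−F} = p(1−p)Z`) has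
`(p∧(1−p))/(p∨(1−p)) · W₂/Z² − ½ ≤ τ_int(1_A) ≤ ½ + 12·(p∨(1−p))/(p∧(1−p)) · W₂/Z²`,
`W₂/Z² = ∫e^{−2F}dπ̄/(∫e^{−F}dπ̄)²` the inverse effective-sample-size fraction of the raw importance
sampler; with the tensorization, a log-weight within `δ` of a sum of `#T` congruent non-degenerate
block-local terms forces `τ_int(1_A) ≥ (p∧(1−p))/(p∨(1−p))·exp(#T·θ − 4δ) − ½` for EVERY
non-trivial event.  The sequel `TorusLinkSignObservableTauInt` evaluates this for the exact
leading-order flow of the model of record.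

## Content (`F` continuous; `A` measurable with `0 < ∫_A e^{−F}dπ̄ < ∫e^{−F}dπ̄`; `p = ∫_A e^{−F}dπ̄/∫e^{−F}dπ̄`;
## `τ_int(1_A) = Scoring.tauInt` of the autocorrelation sequence of `1_A − p` along `imhOp π̄ e^{−F} 1`)

* **`indepSampler_event_tauInt_sandwich`** — the displayed two-sided bound.
* **`indepSampler_event_tauInt_ge_exp_blockSum`** — THE TENSORIZED FLOOR: blocks `B_j ⊆ D_j` with the
  `D_j` pairwise disjoint, `h_j` continuous depending on `D_j` with oscillation `≤ M_j`, `r` continuous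
  depending on the complement of `⋃_j B_j`, `C = Λ ∖ ⋃_j B_j`, `|F − (Σ_j h_j + r)| ≤ δ`:
  `(p∧(1−p))/(p∨(1−p))·e^{−4δ}·exp(Σ_j e^{−4M_j}·Var_π̄(A_C h_j)/(1 + M_j²)) − ½ ≤ τ_int(1_A)`.

NOT CLAIMED: general real observables (row 2's `g²`-weighted floor covers them, not tensorized
here); anything model-specific; numbers.
-/

noncomputable section

namespace Summit.Ventures.LatticeQCDFlow.Exactness

open Function Set Metric MeasureTheory NormedSpace InnerProductSpace
open Summit.Ventures.LatticeQCDFlow.Scoring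
open scoped RealInnerProductSpace Topology

/-! ## §1 The event sandwich on the lattice of spheres -/

section Event

variable {Λ : Type*} {E : Type*} [NormedAddCommGroup E] [InnerProductSpace ℝ E]
  [FiniteDimensional ℝ E] [Fintype Λ] [DecidableEq Λ] [MeasurableSpace E] [BorelSpace E] [Nontrivial E]

omit [DecidableEq Λ] in
/-- **THE EVENT SANDWICH.**  For a continuous log-weight `F` on `Ω` and every measurable event `A`
with `0 < ∫_A e^{−F}dπ̄ < ∫e^{−F}dπ̄` (target probability `p ∈ (0,1)`):
`(p∧(1−p))/(p∨(1−p))·∫e^{−2F}/(∫e^{−F})² − ½ ≤ τ_int(1_A) ≤ ½ + 12·(p∨(1−p))/(p∧(1−p))·∫e^{−2F}/(∫e^{−F})²`,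
`τ_int(1_A)` the integrated autocorrelation time of `1_A − p` along the stationary exact chain
`imhOp π̄ e^{−F} 1`. -/
theorem indepSampler_event_tauInt_sandwich {F : (Λ → sphere (0 : E) 1) → ℝ} (hF : Continuous F)
    {A : Set (Λ → sphere (0 : E) 1)} (hA : MeasurableSet A)
    (hA0 : 0 < ∫ ω in A, Real.exp (-F ω) ∂Measure.pi (fun _ : Λ => uniformSphere (volume : Measure E)))
    (hA1 : ∫ ω in A, Real.exp (-F ω) ∂Measure.pi (fun _ : Λ => uniformSphere (volume : Measure E)) <
      ∫ ω, Real.exp (-F ω) ∂Measure.pi (fun _ : Λ => uniformSphere (volume : Measure E))) :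
    min ((∫ ω in A, Real.exp (-F ω) ∂Measure.pi (fun _ : Λ => uniformSphere (volume : Measure E))) / (∫ ω, Real.exp (-F ω) ∂Measure.pi (fun _ : Λ => uniformSphere (volume : Measure E)))) (1 - ((∫ ω in A, Real.exp (-F ω) ∂Measure.pi (fun _ : Λ => uniformSphere (volume : Measure E))) / (∫ ω, Real.exp (-F ω) ∂Measure.pi (fun _ : Λ => uniformSphere (volume : Measure E))))) /
          max ((∫ ω in A, Real.exp (-F ω) ∂Measure.pi (fun _ : Λ => uniformSphere (volume : Measure E))) / (∫ ω, Real.exp (-F ω) ∂Measure.pi (fun _ : Λ => uniformSphere (volume : Measure E)))) (1 - ((∫ ω in A, Real.exp (-F ω) ∂Measure.pi (fun _ : Λ => uniformSphere (volume : Measure E))) / (∫ ω, Real.exp (-F ω) ∂Measure.pi (fun _ : Λ => uniformSphere (volume : Measure E))))) *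
          ((∫ ω, Real.exp (-2 * F ω) ∂Measure.pi (fun _ : Λ => uniformSphere (volume : Measure E))) /
          (∫ ω, Real.exp (-F ω) ∂Measure.pi (fun _ : Λ => uniformSphere (volume : Measure E))) ^ 2) - 1 / 2 ≤
      tauInt (fun k => (∫ ω, (A.indicator (fun _ => (1 : ℝ)) ω - ((∫ ω in A, Real.exp (-F ω) ∂Measure.pi (fun _ : Λ => uniformSphere (volume : Measure E))) / (∫ ω, Real.exp (-F ω) ∂Measure.pi (fun _ : Λ => uniformSphere (volume : Measure E))))) *
          ((imhOp (Measure.pi (fun _ : Λ => uniformSphere (volume : Measure E))) (fun η => Real.exp (-F η)) (fun _ => (1 : ℝ)))^[k]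
            (fun ω => A.indicator (fun _ => (1 : ℝ)) ω -
            ((∫ ω in A, Real.exp (-F ω) ∂Measure.pi (fun _ : Λ => uniformSphere (volume : Measure E))) / (∫ ω, Real.exp (-F ω) ∂Measure.pi (fun _ : Λ => uniformSphere (volume : Measure E)))))) ω * Real.exp (-F ω) ∂Measure.pi (fun _ : Λ => uniformSphere (volume : Measure E))) /
          ∫ ω, (A.indicator (fun _ => (1 : ℝ)) ω - ((∫ ω in A, Real.exp (-F ω) ∂Measure.pi (fun _ : Λ => uniformSphere (volume : Measure E))) / (∫ ω, Real.exp (-F ω) ∂Measure.pi (fun _ : Λ => uniformSphere (volume : Measure E))))) ^ 2 * Real.exp (-F ω) ∂Measure.pi (fun _ : Λ => uniformSphere (volume : Measure E))) ∧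
    tauInt (fun k => (∫ ω, (A.indicator (fun _ => (1 : ℝ)) ω - ((∫ ω in A, Real.exp (-F ω) ∂Measure.pi (fun _ : Λ => uniformSphere (volume : Measure E))) / (∫ ω, Real.exp (-F ω) ∂Measure.pi (fun _ : Λ => uniformSphere (volume : Measure E))))) *
          ((imhOp (Measure.pi (fun _ : Λ => uniformSphere (volume : Measure E))) (fun η => Real.exp (-F η)) (fun _ => (1 : ℝ)))^[k]
            (fun ω => A.indicator (fun _ => (1 : ℝ)) ω -
            ((∫ ω in A, Real.exp (-F ω) ∂Measure.pi (fun _ : Λ => uniformSphere (volume : Measure E))) / (∫ ω, Real.exp (-F ω) ∂Measure.pi (fun _ : Λ => uniformSphere (volume : Measure E)))))) ω * Real.exp (-F ω) ∂Measure.pi (fun _ : Λ => uniformSphere (volume : Measure E))) /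
          ∫ ω, (A.indicator (fun _ => (1 : ℝ)) ω - ((∫ ω in A, Real.exp (-F ω) ∂Measure.pi (fun _ : Λ => uniformSphere (volume : Measure E))) / (∫ ω, Real.exp (-F ω) ∂Measure.pi (fun _ : Λ => uniformSphere (volume : Measure E))))) ^ 2 * Real.exp (-F ω) ∂Measure.pi (fun _ : Λ => uniformSphere (volume : Measure E))) ≤
      1 / 2 + 12 * (max ((∫ ω in A, Real.exp (-F ω) ∂Measure.pi (fun _ : Λ => uniformSphere (volume : Measure E))) / (∫ ω, Real.exp (-F ω) ∂Measure.pi (fun _ : Λ => uniformSphere (volume : Measure E)))) (1 - ((∫ ω in A, Real.exp (-F ω) ∂Measure.pi (fun _ : Λ => uniformSphere (volume : Measure E))) / (∫ ω, Real.exp (-F ω) ∂Measure.pi (fun _ : Λ => uniformSphere (volume : Measure E))))) /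
          min ((∫ ω in A, Real.exp (-F ω) ∂Measure.pi (fun _ : Λ => uniformSphere (volume : Measure E))) / (∫ ω, Real.exp (-F ω) ∂Measure.pi (fun _ : Λ => uniformSphere (volume : Measure E)))) (1 - ((∫ ω in A, Real.exp (-F ω) ∂Measure.pi (fun _ : Λ => uniformSphere (volume : Measure E))) / (∫ ω, Real.exp (-F ω) ∂Measure.pi (fun _ : Λ => uniformSphere (volume : Measure E)))))) *
          ((∫ ω, Real.exp (-2 * F ω) ∂Measure.pi (fun _ : Λ => uniformSphere (volume : Measure E))) /
          (∫ ω, Real.exp (-F ω) ∂Measure.pi (fun _ : Λ => uniformSphere (volume : Measure E))) ^ 2) := by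
  set μ : Measure (Λ → sphere (0 : E) 1) := Measure.pi (fun _ : Λ => uniformSphere (volume : Measure E)) with hμ
  set Z : ℝ := ∫ ω, Real.exp (-F ω) ∂μ with hZdef
  set ZA : ℝ := ∫ ω in A, Real.exp (-F ω) ∂μ with hZAdef
  set p : ℝ := ZA / Z with hpdef
  have hwc : Continuous fun η : Λ → sphere (0 : E) 1 => Real.exp (-F η) := hF.neg.rexp
  have hw0 : ∀ η : Λ → sphere (0 : E) 1, 0 < Real.exp (-F η) := fun η => Real.exp_pos _
  have hwm : Measurable fun η : Λ → sphere (0 : E) 1 => Real.exp (-F η) := hwc.measurable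
  have hwi : Integrable (fun η : Λ → sphere (0 : E) 1 => Real.exp (-F η)) μ :=
    integrable_pi_of_continuous _ hwc
  have hq0 : ∀ _η : Λ → sphere (0 : E) 1, (0 : ℝ) < 1 := fun _ => one_pos
  have hqm : Measurable fun _ : Λ → sphere (0 : E) 1 => (1 : ℝ) := measurable_const
  have hqi : Integrable (fun _ : Λ → sphere (0 : E) 1 => (1 : ℝ)) μ := integrable_const _
  have hq1 : ∫ _ : Λ → sphere (0 : E) 1, (1 : ℝ) ∂μ = 1 := by
    rw [integral_const, smul_eq_mul, mul_one, probReal_univ]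
  have hw2c : Continuous fun η : Λ → sphere (0 : E) 1 => Real.exp (-F η) / 1 * Real.exp (-F η) :=
    (hwc.div_const 1).mul hwc
  have hW₂ : Integrable (fun η : Λ → sphere (0 : E) 1 => Real.exp (-F η) / 1 * Real.exp (-F η)) μ :=
    integrable_pi_of_continuous _ hw2c
  have hZpos : 0 < Z := integral_exp_pos (integrable_pi_of_continuous _ (Real.continuous_exp.comp hF.neg))
  have hp0 : 0 < p := div_pos hA0 hZpos
  have hp1 : p < 1 := (div_lt_one hZpos).2 hA1
  have hq : 0 < 1 - p := by linarith
  have hmin : 0 < min p (1 - p) := lt_min hp0 hq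
  have hmax : 0 < max p (1 - p) := lt_max_of_lt_left hp0
  -- `(p∧(1−p))²/(p(1−p)) = (p∧(1−p))/(p∨(1−p))` and dually
  have hmin_eq : min p (1 - p) ^ 2 / (p * (1 - p)) = min p (1 - p) / max p (1 - p) := by
    rcases le_total p (1 - p) with h | h
    · rw [min_eq_left h, max_eq_right h, sq, mul_div_mul_left _ _ hp0.ne']
    · rw [min_eq_right h, max_eq_left h, sq, mul_comm p (1 - p), mul_div_mul_left _ _ hq.ne']
  have hmax_eq : max p (1 - p) ^ 2 / (p * (1 - p)) = max p (1 - p) / min p (1 - p) := by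
    rcases le_total p (1 - p) with h | h
    · rw [min_eq_left h, max_eq_right h, sq, mul_comm p (1 - p), mul_div_mul_left _ _ hq.ne']
    · rw [min_eq_right h, max_eq_left h, sq, mul_div_mul_left _ _ hp0.ne']
  -- the centred indicator
  have hgm : Measurable fun ω : Λ → sphere (0 : E) 1 => A.indicator (fun _ => (1 : ℝ)) ω - p :=
    (measurable_const.indicator hA).sub measurable_const
  have hgb : ∀ ω : Λ → sphere (0 : E) 1, |A.indicator (fun _ => (1 : ℝ)) ω - p| ≤ max p (1 - p) := by
    intro ω
    by_cases hω : ω ∈ A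
    · rw [Set.indicator_of_mem hω, abs_of_pos (by linarith)]
      exact le_max_right _ _
    · rw [Set.indicator_of_notMem hω, zero_sub, abs_neg, abs_of_pos hp0]
      exact le_max_left _ _
  have hZA' : ∫ ω, A.indicator (fun η => Real.exp (-F η)) ω ∂μ = ZA := integral_indicator hA
  have hind : ∀ ω : Λ → sphere (0 : E) 1, A.indicator (fun _ => (1 : ℝ)) ω * Real.exp (-F ω) =
      A.indicator (fun η => Real.exp (-F η)) ω := by
    intro ω
    by_cases hω : ω ∈ A
    · rw [Set.indicator_of_mem hω, Set.indicator_of_mem hω, one_mul]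
    · rw [Set.indicator_of_notMem hω, Set.indicator_of_notMem hω, zero_mul]
  have hg0 : ∫ ω, (A.indicator (fun _ => (1 : ℝ)) ω - p) * Real.exp (-F ω) ∂μ = 0 := by
    have e : ∀ ω : Λ → sphere (0 : E) 1, (A.indicator (fun _ => (1 : ℝ)) ω - p) * Real.exp (-F ω) =
        A.indicator (fun η => Real.exp (-F η)) ω - p * Real.exp (-F ω) := by
      intro ω; rw [sub_mul, hind ω]
    simp_rw [e]
    rw [integral_sub (hwi.indicator hA) (hwi.const_mul p), hZA', integral_const_mul]
    rw [hpdef, div_mul_cancel₀ _ hZpos.ne', sub_self]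
  have hgsq : ∫ ω, (A.indicator (fun _ => (1 : ℝ)) ω - p) ^ 2 * Real.exp (-F ω) ∂μ = p * (1 - p) * Z := by
    have e : ∀ ω : Λ → sphere (0 : E) 1, (A.indicator (fun _ => (1 : ℝ)) ω - p) ^ 2 * Real.exp (-F ω) =
        (1 - 2 * p) * A.indicator (fun η => Real.exp (-F η)) ω + p ^ 2 * Real.exp (-F ω) := by
      intro ω
      by_cases hω : ω ∈ A
      · rw [Set.indicator_of_mem hω, Set.indicator_of_mem hω]; ring
      · rw [Set.indicator_of_notMem hω, Set.indicator_of_notMem hω]; ring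
    simp_rw [e]
    rw [integral_add ((hwi.indicator hA).const_mul _) (hwi.const_mul _), integral_const_mul,
      integral_const_mul, hZA']
    have hZA2 : ZA = p * Z := by rw [hpdef, div_mul_cancel₀ _ hZpos.ne']
    rw [hZA2]
    ring
  have hD : 0 < p * (1 - p) * Z := by positivity
  -- the numerator of row 2's floor: `∫ g²·(w/1·w) ≥ (p∧(1−p))²·∫e^{−2F}`
  have hw2 : ∀ ω : Λ → sphere (0 : E) 1, Real.exp (-F ω) / 1 * Real.exp (-F ω) = Real.exp (-2 * F ω) := by
    intro ω; rw [div_one, ← Real.exp_add]; congr 1; ring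
  have hnum : min p (1 - p) ^ 2 * ∫ ω, Real.exp (-2 * F ω) ∂μ ≤
      ∫ ω, (A.indicator (fun _ => (1 : ℝ)) ω - p) ^ 2 * (Real.exp (-F ω) / 1 * Real.exp (-F ω)) ∂μ := by
    rw [← integral_const_mul]
    refine integral_mono ((integrable_pi_of_continuous _ (continuous_const.mul hF).rexp).const_mul _)
      ?_ fun ω => ?_
    · refine hW₂.bdd_mul (c := max p (1 - p) ^ 2) (hgm.pow_const 2).aestronglyMeasurable
        (ae_of_all _ fun ω => ?_)
      rw [Real.norm_eq_abs, abs_pow, sq_abs, ← sq_abs]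
      exact pow_le_pow_left₀ (abs_nonneg _) (hgb ω) 2
    · show min p (1 - p) ^ 2 * Real.exp (-2 * F ω) ≤
        (A.indicator (fun _ => (1 : ℝ)) ω - p) ^ 2 * (Real.exp (-F ω) / 1 * Real.exp (-F ω))
      rw [hw2 ω]
      refine mul_le_mul_of_nonneg_right ?_ (Real.exp_pos _).le
      by_cases hω : ω ∈ A
      · rw [Set.indicator_of_mem hω]
        have h1 : min p (1 - p) ≤ 1 - p := min_le_right _ _
        nlinarith [hmin]
      · rw [Set.indicator_of_notMem hω, zero_sub, neg_sq]
        have h1 : min p (1 - p) ≤ p := min_le_left _ _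
        nlinarith [hmin]
  have hW2eq : ∫ ω, Real.exp (-F ω) / 1 * Real.exp (-F ω) ∂μ = ∫ ω, Real.exp (-2 * F ω) ∂μ :=
    integral_congr_ae (ae_of_all _ fun ω => hw2 ω)
  constructor
  · have hlow := imhOp_tauInt_ge_weightMean hw0 hwm hwi hq0 hqm hqi hq1 hW₂ hgm hgb hg0
    rw [← hZdef] at hlow
    refine le_trans ?_ hlow
    rw [hgsq, ← hmin_eq]
    refine sub_le_sub_right ?_ _
    -- `min²/(p(1−p)) · W₂/Z² ≤ ∫g²w² / (Z·(p(1−p)Z))`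
    rw [div_mul_div_comm, div_le_div_iff₀ (by positivity) (by positivity)]
    calc min p (1 - p) ^ 2 * (∫ ω, Real.exp (-2 * F ω) ∂μ) * (Z * (p * (1 - p) * Z))
        = (min p (1 - p) ^ 2 * ∫ ω, Real.exp (-2 * F ω) ∂μ) * (p * (1 - p) * Z ^ 2) := by ring
      _ ≤ (∫ ω, (A.indicator (fun _ => (1 : ℝ)) ω - p) ^ 2 * (Real.exp (-F ω) / 1 * Real.exp (-F ω)) ∂μ) *
            (p * (1 - p) * Z ^ 2) := mul_le_mul_of_nonneg_right hnum (by positivity)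
  · have hup := imhOp_tauInt_le_invESS hw0 hwm hwi hq0 hqm hqi hq1 hW₂ hgm hgb hg0
    rw [← hZdef] at hup
    refine hup.trans ?_
    rw [hgsq, hW2eq, ← hmax_eq]
    apply le_of_eq
    field_simp

/-- **THE TENSORIZED `τ_int` FLOOR FOR EVENTS.**  Blocks `B_j ⊆ D_j` with the `D_j` pairwise disjoint
(`j ∈ T`); `h_j` continuous, depending on `D_j`, with oscillation `≤ M_j` (`0 ≤ M_j`); `r`
continuous depending on the complement of `⋃_j B_j`; `C = Λ ∖ ⋃_j B_j`; a continuous log-weight `F`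
with `|F − (Σ_j h_j + r)| ≤ δ`; a measurable event `A` of target probability `p ∈ (0,1)`.  Then
`(p∧(1−p))/(p∨(1−p))·e^{−4δ}·exp(Σ_j e^{−4M_j}·∫(A_C h_j − ∫h_j)²dπ̄/(1 + M_j²)) − ½ ≤ τ_int(1_A)`. -/
theorem indepSampler_event_tauInt_ge_exp_blockSum {J : Type*} (T : Finset J) (B D : J → Finset Λ)
    (hBD : ∀ j ∈ T, B j ⊆ D j) (hD : ∀ j ∈ T, ∀ j' ∈ T, j ≠ j' → Disjoint (D j) (D j'))
    {h : J → (Λ → sphere (0 : E) 1) → ℝ} (hc : ∀ j ∈ T, Continuous (h j))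
    (hdep : ∀ j ∈ T, DependsOn (h j) ↑(D j))
    {M : J → ℝ} (hM0 : ∀ j ∈ T, 0 ≤ M j) (hM : ∀ j ∈ T, ∀ ω ω', |h j ω - h j ω'| ≤ M j)
    {r : (Λ → sphere (0 : E) 1) → ℝ} (hr : Continuous r) (hrdep : DependsOn r (↑(T.biUnion B) : Set Λ)ᶜ)
    {F : (Λ → sphere (0 : E) 1) → ℝ} (hF : Continuous F) {δ : ℝ}
    (hδ : ∀ ω, |F ω - (∑ j ∈ T, h j ω + r ω)| ≤ δ)
    {A : Set (Λ → sphere (0 : E) 1)} (hA : MeasurableSet A)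
    (hA0 : 0 < ∫ ω in A, Real.exp (-F ω) ∂Measure.pi (fun _ : Λ => uniformSphere (volume : Measure E)))
    (hA1 : ∫ ω in A, Real.exp (-F ω) ∂Measure.pi (fun _ : Λ => uniformSphere (volume : Measure E)) <
      ∫ ω, Real.exp (-F ω) ∂Measure.pi (fun _ : Λ => uniformSphere (volume : Measure E))) :
    min ((∫ ω in A, Real.exp (-F ω) ∂Measure.pi (fun _ : Λ => uniformSphere (volume : Measure E))) / (∫ ω, Real.exp (-F ω) ∂Measure.pi (fun _ : Λ => uniformSphere (volume : Measure E)))) (1 - ((∫ ω in A, Real.exp (-F ω) ∂Measure.pi (fun _ : Λ => uniformSphere (volume : Measure E))) / (∫ ω, Real.exp (-F ω) ∂Measure.pi (fun _ : Λ => uniformSphere (volume : Measure E))))) /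
          max ((∫ ω in A, Real.exp (-F ω) ∂Measure.pi (fun _ : Λ => uniformSphere (volume : Measure E))) / (∫ ω, Real.exp (-F ω) ∂Measure.pi (fun _ : Λ => uniformSphere (volume : Measure E)))) (1 - ((∫ ω in A, Real.exp (-F ω) ∂Measure.pi (fun _ : Λ => uniformSphere (volume : Measure E))) / (∫ ω, Real.exp (-F ω) ∂Measure.pi (fun _ : Λ => uniformSphere (volume : Measure E))))) *
        (Real.exp (-(4 * δ)) * Real.exp (∑ j ∈ T, Real.exp (-4 * M j) *
          (∫ ω, (coordAvg (uniformSphere (volume : Measure E)) (Finset.univ \ T.biUnion B) (h j) ω -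
              ∫ ω', h j ω' ∂Measure.pi (fun _ : Λ => uniformSphere (volume : Measure E))) ^ 2
            ∂Measure.pi (fun _ : Λ => uniformSphere (volume : Measure E))) / (1 + M j ^ 2))) - 1 / 2 ≤
      tauInt (fun k => (∫ ω, (A.indicator (fun _ => (1 : ℝ)) ω - ((∫ ω in A, Real.exp (-F ω) ∂Measure.pi (fun _ : Λ => uniformSphere (volume : Measure E))) / (∫ ω, Real.exp (-F ω) ∂Measure.pi (fun _ : Λ => uniformSphere (volume : Measure E))))) *
          ((imhOp (Measure.pi (fun _ : Λ => uniformSphere (volume : Measure E))) (fun η => Real.exp (-F η)) (fun _ => (1 : ℝ)))^[k]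
            (fun ω => A.indicator (fun _ => (1 : ℝ)) ω -
            ((∫ ω in A, Real.exp (-F ω) ∂Measure.pi (fun _ : Λ => uniformSphere (volume : Measure E))) / (∫ ω, Real.exp (-F ω) ∂Measure.pi (fun _ : Λ => uniformSphere (volume : Measure E)))))) ω * Real.exp (-F ω) ∂Measure.pi (fun _ : Λ => uniformSphere (volume : Measure E))) /
          ∫ ω, (A.indicator (fun _ => (1 : ℝ)) ω - ((∫ ω in A, Real.exp (-F ω) ∂Measure.pi (fun _ : Λ => uniformSphere (volume : Measure E))) / (∫ ω, Real.exp (-F ω) ∂Measure.pi (fun _ : Λ => uniformSphere (volume : Measure E))))) ^ 2 * Real.exp (-F ω) ∂Measure.pi (fun _ : Λ => uniformSphere (volume : Measure E))) := by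
  have hsand := (indepSampler_event_tauInt_sandwich (Λ := Λ) (E := E) hF hA hA0 hA1).1
  refine le_trans ?_ hsand
  have hmain := sq_integral_exp_neg_mul_exp_le_of_abs_sub_le (uniformSphere (volume : Measure E)) T B D
    hBD hD hc hdep hM0 hM hr hrdep hF hδ
  have hZpos : 0 < ∫ ω, Real.exp (-F ω) ∂Measure.pi (fun _ : Λ => uniformSphere (volume : Measure E)) :=
    integral_exp_pos (integrable_pi_of_continuous _ (Real.continuous_exp.comp hF.neg))
  have hZ2 : 0 < (∫ ω, Real.exp (-F ω) ∂Measure.pi (fun _ : Λ => uniformSphere (volume : Measure E))) ^ 2 := pow_pos hZpos 2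
  have hp0 : 0 < ((∫ ω in A, Real.exp (-F ω) ∂Measure.pi (fun _ : Λ => uniformSphere (volume : Measure E))) / (∫ ω, Real.exp (-F ω) ∂Measure.pi (fun _ : Λ => uniformSphere (volume : Measure E)))) := div_pos hA0 hZpos
  have hp1 : ((∫ ω in A, Real.exp (-F ω) ∂Measure.pi (fun _ : Λ => uniformSphere (volume : Measure E))) / (∫ ω, Real.exp (-F ω) ∂Measure.pi (fun _ : Λ => uniformSphere (volume : Measure E)))) < 1 := (div_lt_one hZpos).2 hA1
  have hcoef : 0 ≤ min ((∫ ω in A, Real.exp (-F ω) ∂Measure.pi (fun _ : Λ => uniformSphere (volume : Measure E))) / (∫ ω, Real.exp (-F ω) ∂Measure.pi (fun _ : Λ => uniformSphere (volume : Measure E)))) (1 - ((∫ ω in A, Real.exp (-F ω) ∂Measure.pi (fun _ : Λ => uniformSphere (volume : Measure E))) / (∫ ω, Real.exp (-F ω) ∂Measure.pi (fun _ : Λ => uniformSphere (volume : Measure E))))) /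
          max ((∫ ω in A, Real.exp (-F ω) ∂Measure.pi (fun _ : Λ => uniformSphere (volume : Measure E))) / (∫ ω, Real.exp (-F ω) ∂Measure.pi (fun _ : Λ => uniformSphere (volume : Measure E)))) (1 - ((∫ ω in A, Real.exp (-F ω) ∂Measure.pi (fun _ : Λ => uniformSphere (volume : Measure E))) / (∫ ω, Real.exp (-F ω) ∂Measure.pi (fun _ : Λ => uniformSphere (volume : Measure E))))) :=
    div_nonneg (le_min hp0.le (by linarith)) (le_max_of_le_left hp0.le)
  have key : Real.exp (-(4 * δ)) * Real.exp (∑ j ∈ T, Real.exp (-4 * M j) *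
        (∫ ω, (coordAvg (uniformSphere (volume : Measure E)) (Finset.univ \ T.biUnion B) (h j) ω -
            ∫ ω', h j ω' ∂Measure.pi (fun _ : Λ => uniformSphere (volume : Measure E))) ^ 2
          ∂Measure.pi (fun _ : Λ => uniformSphere (volume : Measure E))) / (1 + M j ^ 2)) ≤
      ((∫ ω, Real.exp (-2 * F ω) ∂Measure.pi (fun _ : Λ => uniformSphere (volume : Measure E))) /
          (∫ ω, Real.exp (-F ω) ∂Measure.pi (fun _ : Λ => uniformSphere (volume : Measure E))) ^ 2) := by
    rw [le_div_iff₀ hZ2, Real.exp_neg, inv_mul_eq_div, div_mul_eq_mul_div, div_le_iff₀ (Real.exp_pos _)]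
    calc Real.exp (∑ j ∈ T, Real.exp (-4 * M j) *
            (∫ ω, (coordAvg (uniformSphere (volume : Measure E)) (Finset.univ \ T.biUnion B) (h j) ω -
                ∫ ω', h j ω' ∂Measure.pi (fun _ : Λ => uniformSphere (volume : Measure E))) ^ 2
              ∂Measure.pi (fun _ : Λ => uniformSphere (volume : Measure E))) / (1 + M j ^ 2)) *
          (∫ ω, Real.exp (-F ω) ∂Measure.pi (fun _ : Λ => uniformSphere (volume : Measure E))) ^ 2
        = (∫ ω, Real.exp (-F ω) ∂Measure.pi (fun _ : Λ => uniformSphere (volume : Measure E))) ^ 2 *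
          Real.exp (∑ j ∈ T, Real.exp (-4 * M j) *
            (∫ ω, (coordAvg (uniformSphere (volume : Measure E)) (Finset.univ \ T.biUnion B) (h j) ω -
                ∫ ω', h j ω' ∂Measure.pi (fun _ : Λ => uniformSphere (volume : Measure E))) ^ 2
              ∂Measure.pi (fun _ : Λ => uniformSphere (volume : Measure E))) / (1 + M j ^ 2)) := mul_comm _ _
      _ ≤ Real.exp (4 * δ) * (∫ ω, Real.exp (-2 * F ω) ∂Measure.pi (fun _ : Λ => uniformSphere (volume : Measure E))) := hmain
      _ = (∫ ω, Real.exp (-2 * F ω) ∂Measure.pi (fun _ : Λ => uniformSphere (volume : Measure E))) * Real.exp (4 * δ) := mul_comm _ _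
  linarith [mul_le_mul_of_nonneg_left key hcoef]

end Event

end Summit.Ventures.LatticeQCDFlow.Exactness

end
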